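import Summits.ValiantsHypothesis.ValiantsHypothesis.Theorems.Depth5ChasmQuotClosure
import Summits.ValiantsHypothesis.ValiantsHypothesis.Theorems.Depth4ChasmAxis
import Literature.Computability.AlgebraicComplexity.ArithCircuitComposition
import HarnessLib
import HarnessLib.Audit

/-!
# The cube-root chasm `DepthFiveChasm` holds in the kernel (inhomogeneous `ΣΠΣΠΣ` over `ℂ`)

File 2 of 2 (file 1 = `Depth5ChasmQuotClosure`); route `Depth4`, lens-4 of the `decomp-valiant`
workshop, generation 22.  Sorry-free; no Literature fact, no `Prop` definition; tree constructions USED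
BY NAME.  `Theorems.Depth4ChasmAxis.DepthFiveChasm` was a TYPED STUB: for every `VP` family `f` over `ℂ`
there is `c` with `productDepthCircuitSize 2 (f n) ≤ (n+2)^(c·k+c)` whenever `deg (f n) ≤ k³`
(Kumar–Saptharishi 2017, Lemma 28–29: Tavenas at cut degree `k²`, again at `k` inside every bottom
product, then the GKKS depth-3 step on the degree-`≤ k` pieces).  `depthFiveChasm_holds` proves it with
`c = 402·(a₁+a₂+a₃+2)` for the p-bounds `(a₁, a₂, a₃)` of (variables, degree, complexity); hence
UNCONDITIONALLY `vh_of_depth5InhomThesis : Depth5InhomThesis → VP ≠ VNP`,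
`vh_of_depth4GeneralExp : Depth4GeneralExp → VP ≠ VNP` (item 0331 is summit-sufficient on this
measure) and `not_depth5Inhom_witness_of_vpSaturated'` (the cell's meta-lock, was modulo the stub).
Proof: level 1 (`exists_pd2_circuit_of_terms`) = the terms of `expand (k²)` at the `d+1` output
components of `SLP.homogenize`, assembled by ONE composition `slotCircuit ∘ (pieces)`
(`ArithCircuit.compose`, product-depth `1 + 1`) over the piece circuits of file 1; §4: with
`M = (n+2)^(a+2)` the gate count `slpBound N d s k` is `≤ M^(402 k)`.  Honest grade: KNOWN in print
(Kumar–Saptharishi 2017); kernel-new; a typed stub of the chasm axis becomes a kernel theorem; rung 0.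
USES (by name): file 1, `SLP.homogenize/inv_expand/final_expand/card_node_le`, `DepthReduction.exists_slp/
sum_flatMap/sum_homogeneousComponent_of_le/prod_getD_one`, `ArithCircuit.compose` API, `Depth4ChasmAxis.*`.
-/

set_option linter.dupNamespace false

noncomputable section

open MvPolynomial
open Literature.Computability.AlgebraicComplexity
open Literature.Computability.AlgebraicComplexity.DepthReduction
open Literature.Computability.AlgebraicComplexity.DepthThreeChasm
open Summit.ValiantsHypothesis.ValiantsHypothesis.Theses.Depth4
open Summit.ValiantsHypothesis.ValiantsHypothesis.Theorems.Depth4ChasmAxis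

namespace Summit.ValiantsHypothesis.ValiantsHypothesis.Theorems.Depth5Chasm

universe u v w

/-! ## §3 (continued) Terms and straight-line programs -/

section TwoLevel

variable {τ : Type v} [Fintype τ] [DecidableEq τ] [Inhabited τ] {ι : Type w} [Fintype ι] [DecidableEq ι]

/-- **Level 1 (assembly of terms).** A list `L` of terms (lists of atoms) of a homogeneous circuit
certificate over `ℂ`, each of length `≤ W₁` with atoms of formal degree `≤ t₁`, has a product-depth-`≤ 2`
circuit computing `Σ_{T ∈ L} Π_{a ∈ T} aval a` with `≤ |L|·W₁·pieceBound + (|L|·W₁ + |L| + 1)` gates: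
ONE composition of the skeleton `Σ_i Π_j X_{(i,j)}` (a `slotCircuit`) with the piece circuits.
[cite: KumarSaptharishi2017, Lemma 28–29; Burgisser2000, Rem. 2.7; LimayeSrinivasanTavenas2021, §2] -/
theorem exists_pd2_circuit_of_terms (H : HomCircuit ℂ τ ι) {t₁ t₂ W₁ : ℕ} (ht₂ : 1 ≤ t₂)
    (L : List (List (HomCircuit.Atom ι))) (hlen : ∀ T ∈ L, T.length ≤ W₁)
    (hfin : ∀ T ∈ L, ∀ a ∈ T, H.adeg a ≤ t₁) :
    ∃ C : ArithCircuit ℂ τ, C.eval = (L.map H.tval).sum ∧ C.productDepth ≤ 2 ∧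
      C.size ≤ L.length * W₁ * pieceBound (Fintype.card ι) (Fintype.card τ) t₁ t₂ +
        (L.length * W₁ + L.length + 1) := by
  -- a piece circuit for every atom (junk for atoms of large formal degree)
  have hall : ∀ a : HomCircuit.Atom ι, ∃ C : ArithCircuit ℂ τ,
      (H.adeg a ≤ t₁ → C.eval = H.aval a) ∧ C.productDepth ≤ 1 ∧
        C.size ≤ pieceBound (Fintype.card ι) (Fintype.card τ) t₁ t₂ := by
    intro a
    by_cases ha : H.adeg a ≤ t₁
    · obtain ⟨C, h1, h2, h3⟩ := exists_piece_circuit H ht₂ a ha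
      exact ⟨C, fun _ => h1, h2, h3⟩
    · exact ⟨ArithCircuit.ofConst 0, fun h => absurd h ha,
        by rw [productDepth_ofConst]; exact Nat.zero_le _,
        by rw [ArithCircuit.size_ofConst]; exact Nat.zero_le _⟩
  choose Cof hCe hCd hCs using hall
  -- the inner circuits and the values they compute
  let Q : Fin L.length × Fin W₁ → ArithCircuit ℂ τ := fun x =>
    if h : x.2.val < (L[x.1.val]).length then Cof ((L[x.1.val])[x.2.val]) else ArithCircuit.ofConst 1
  let g : Fin L.length × Fin W₁ → MvPolynomial τ ℂ := fun x =>
    ((L[x.1.val]).map H.aval).getD x.2.val 1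
  have hQ : ∀ x, (Q x).Computes (g x) := by
    rintro ⟨i, j⟩
    show (Q (i, j)).eval = g (i, j)
    simp only [Q, g]
    rw [List.getD_eq_getElem?_getD, List.getElem?_map]
    split_ifs with h
    · rw [List.getElem?_eq_getElem h]
      exact hCe _ (hfin _ (List.getElem_mem _) _ (List.getElem_mem _))
    · rw [List.getElem?_eq_none (Nat.le_of_not_lt h)]
      exact (ArithCircuit.eval_ofConst _).trans (by simp)
  have hQd : ∀ x, (Q x).productDepth ≤ 1 := by
    rintro ⟨i, j⟩
    simp only [Q]
    split_ifs with h
    · exact hCd _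
    · rw [productDepth_ofConst]; exact Nat.zero_le _
  have hQs : ∀ x, (Q x).size ≤ pieceBound (Fintype.card ι) (Fintype.card τ) t₁ t₂ := by
    rintro ⟨i, j⟩
    simp only [Q]
    split_ifs with h
    · exact hCs _
    · rw [ArithCircuit.size_ofConst]; exact Nat.zero_le _
  -- the outer `ΣΠ` skeleton `Σ_i Π_j X (i, j)` (one-slot affine forms)
  have hPe : (slotCircuit (fun _ => (1 : ℂ)) (fun (i : Fin L.length) (j : Fin W₁) =>
      (⟨fun _ => 1, fun _ => (i, j), 0⟩ : AffForm ℂ (Fin L.length × Fin W₁) 1))).Computes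
      (∑ i : Fin L.length, ∏ j : Fin W₁, X (i, j)) := by
    show ArithCircuit.eval _ = _
    rw [eval_slotCircuit]
    simp only [one_smul, val_slotVar]
  have hc := ArithCircuit.Computes.compose hPe hQ
  refine ⟨(slotCircuit (fun _ => (1 : ℂ)) (fun (i : Fin L.length) (j : Fin W₁) =>
      (⟨fun _ => 1, fun _ => (i, j), 0⟩ : AffForm ℂ (Fin L.length × Fin W₁) 1))).compose Q,
    ?_, ?_, ?_⟩
  · -- value
    have hc' : ArithCircuit.eval _ = _ := hc
    refine hc'.trans ?_
    rw [map_sum, ← Fin.sum_univ_fun_getElem L H.tval]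
    refine Fintype.sum_congr _ _ fun i => ?_
    rw [map_prod]
    simp only [aeval_X, g]
    exact prod_getD_one ((L[i.1]).map H.aval) W₁
      (by rw [List.length_map]; exact hlen _ (List.getElem_mem _))
  · -- product depth `1 + 1`
    exact (ArithCircuit.productDepth_compose_le hQd _).trans
      (Nat.add_le_add_right (productDepth_slotCircuit_le _ _) 1)
  · -- gates
    have hPs : (slotCircuit (fun _ => (1 : ℂ)) (fun (i : Fin L.length) (j : Fin W₁) =>
        (⟨fun _ => 1, fun _ => (i, j), 0⟩ : AffForm ℂ (Fin L.length × Fin W₁) 1))).size =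
        L.length * W₁ + L.length + 1 := by
      simp only [slotCircuit, ArithCircuit.size, List.length_append, length_layerF, length_layerQ,
        List.length_singleton]
    rw [ArithCircuit.size_compose, hPs]
    calc L.length * W₁ + L.length + 1 + ∑ x, (Q x).size
        ≤ L.length * W₁ + L.length + 1 +
            ∑ _x : Fin L.length × Fin W₁, pieceBound (Fintype.card ι) (Fintype.card τ) t₁ t₂ :=
          Nat.add_le_add_left (Finset.sum_le_sum fun x _ => hQs x) _
      _ = L.length * W₁ * pieceBound (Fintype.card ι) (Fintype.card τ) t₁ t₂ +
            (L.length * W₁ + L.length + 1) := by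
          simp only [Finset.sum_const, Finset.card_univ, smul_eq_mul, Fintype.card_prod,
            Fintype.card_fin]
          ring

/-- **A value of a straight-line program in product-depth `2`.** A value of degree `≤ d` of a
straight-line program of length `s` over `N` variables (over `ℂ`) has, for every `k ≥ 1`, a
product-depth-`≤ 2` circuit with `≤ slpBound N d s k` gates. [cite: KumarSaptharishi2017, Lemma 29] -/
theorem exists_pd2_circuit_of_slp (S : SLP ℂ τ) {i : ℕ} (hi : i < S.len) {d k : ℕ}
    (hd : (S.val i).totalDegree ≤ d) (hk : 1 ≤ k) :
    ∃ C : ArithCircuit ℂ τ, C.eval = S.val i ∧ C.productDepth ≤ 2 ∧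
      C.size ≤ slpBound (Fintype.card τ) d S.len k := by
  classical
  have ht₁ : 1 ≤ k ^ 2 := Nat.one_le_pow _ _ hk
  haveI : Nonempty (S.Node d) := ⟨(⟨i, hi⟩, SLP.Tag.Q 0)⟩
  -- per output component `e`: the terms of the expansion at cut degree `k²`
  have key : ∀ (e : Fin (d + 1)), ∀ T ∈ (S.homogenize d).expand (k ^ 2) (⟨i, hi⟩, SLP.Tag.Q e)
      (8 * e.val / (k ^ 2 + 1)), T.length ≤ width d (k ^ 2) ∧
        ∀ a ∈ T, (S.homogenize d).adeg a ≤ k ^ 2 := by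
    intro e T hT
    have hinv := (S.homogenize d).inv_expand ht₁ (⟨i, hi⟩, SLP.Tag.Q e) (8 * e.val / (k ^ 2 + 1))
    refine ⟨(hinv.length_le T hT).trans ?_,
      (S.homogenize d).final_expand ht₁ (⟨i, hi⟩, SLP.Tag.Q e) T hT⟩
    have := e.isLt
    unfold width rounds
    apply Nat.add_le_add_left
    apply Nat.mul_le_mul_left
    apply Nat.div_le_div_right
    omega
  set L := (List.finRange (d + 1)).flatMap fun e =>
    (S.homogenize d).expand (k ^ 2) (⟨i, hi⟩, SLP.Tag.Q e) (8 * e.val / (k ^ 2 + 1)) with hL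
  have hlen : ∀ T ∈ L, T.length ≤ width d (k ^ 2) := by
    intro T hT
    rw [hL] at hT
    obtain ⟨e, -, hT⟩ := List.mem_flatMap.1 hT
    exact (key e T hT).1
  have hfin : ∀ T ∈ L, ∀ a ∈ T, (S.homogenize d).adeg a ≤ k ^ 2 := by
    intro T hT
    rw [hL] at hT
    obtain ⟨e, -, hT⟩ := List.mem_flatMap.1 hT
    exact (key e T hT).2
  have hsum : (L.map (S.homogenize d).tval).sum = S.val i := by
    rw [hL, List.map_flatMap, sum_flatMap, ← sum_homogeneousComponent_of_le hd,
      ← Fin.sum_univ_eq_sum_range (fun e => homogeneousComponent e (S.val i)) (d + 1),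
      Fin.sum_univ_def]
    congr 1
    apply List.map_congr_left
    intro e _
    exact ((S.homogenize d).inv_expand ht₁ (⟨i, hi⟩, SLP.Tag.Q e) (8 * e.val / (k ^ 2 + 1))).sum_eq
  have hpos : 0 < Fintype.card (S.Node d) * Fintype.card (S.Node d) :=
    Nat.mul_pos Fintype.card_pos Fintype.card_pos
  have hlenL : L.length ≤
      (d + 1) * (Fintype.card (S.Node d) * Fintype.card (S.Node d)) ^ rounds d (k ^ 2) := by
    rw [hL, List.length_flatMap]
    refine (List.sum_le_card_nsmul _
      ((Fintype.card (S.Node d) * Fintype.card (S.Node d)) ^ rounds d (k ^ 2)) ?_).trans ?_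
    · intro x hx
      obtain ⟨e, -, rfl⟩ := List.mem_map.1 hx
      refine ((S.homogenize d).inv_expand ht₁ (⟨i, hi⟩, SLP.Tag.Q e)
        (8 * e.val / (k ^ 2 + 1))).card_le.trans ?_
      apply Nat.pow_le_pow_right hpos
      have := e.isLt
      unfold rounds
      apply Nat.div_le_div_right
      omega
    · simp
  obtain ⟨C, hCe, hCd, hCs⟩ := exists_pd2_circuit_of_terms (S.homogenize d) (t₂ := k) hk L hlen hfin
  refine ⟨C, hCe.trans hsum, hCd, hCs.trans ?_⟩
  have hS₁ : Fintype.card (S.Node d) ≤ nodeBound S.len d := S.card_node_le d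
  have hT₁ : L.length ≤ (d + 1) * (nodeBound S.len d * nodeBound S.len d) ^ rounds d (k ^ 2) :=
    hlenL.trans (Nat.mul_le_mul_left _ (Nat.pow_le_pow_left (Nat.mul_le_mul hS₁ hS₁) _))
  have hPB := pieceBound_mono hS₁ (Fintype.card τ) (k ^ 2) k
  unfold slpBound
  exact Nat.add_le_add (Nat.mul_le_mul (Nat.mul_le_mul_right _ hT₁) hPB)
    (Nat.add_le_add_right (Nat.add_le_add (Nat.mul_le_mul_right _ hT₁) hT₁) 1)

end TwoLevel

/-! ## §4 The exponent and the headline -/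

section Arithmetic

/-- **The gate count is `M^(402 k)`** when `N, d+1, s ≤ M`, `M ≥ 2`, `1 ≤ k`, `d ≤ k³`.
[cite: KumarSaptharishi2017, Lemma 29 (size `s^{O(d^{1/3})}`), our constants] -/
theorem slpBound_le_pow {M N d s k : ℕ} (hM : 2 ≤ M) (hN : N ≤ M) (hd1 : d + 1 ≤ M) (hs : s ≤ M)
    (hk : 1 ≤ k) (hdk : d ≤ k ^ 3) :
    slpBound N d s k ≤ M ^ (402 * k) := by
  -- monotone arithmetic in the shape `x ≤ M^e` (local; `hM` threaded to keep call shapes uniform)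
  have kle_pow_mul : ∀ {a b x y : ℕ}, a ≤ M ^ x → b ≤ M ^ y → a * b ≤ M ^ (x + y) :=
    fun ha hb => by rw [pow_add]; exact Nat.mul_le_mul ha hb
  have kadd_le_pow : ∀ {a b x : ℕ}, 2 ≤ M → a ≤ M ^ x → b ≤ M ^ x → a + b ≤ M ^ (x + 1) :=
    fun {a b x} hM ha hb => calc a + b ≤ M ^ x + M ^ x := Nat.add_le_add ha hb
      _ = M ^ x * 2 := by ring
      _ ≤ M ^ x * M := Nat.mul_le_mul_left _ hM
      _ = M ^ (x + 1) := by rw [pow_succ]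
  have ksucc_le_pow : ∀ {a x : ℕ}, 2 ≤ M → a ≤ M ^ x → a + 1 ≤ M ^ (x + 1) :=
    fun hM ha => kadd_le_pow hM ha (Nat.one_le_pow _ _ (by omega))
  have kpow_le_pow_mul : ∀ {a x : ℕ}, a ≤ M ^ x → ∀ r : ℕ, a ^ r ≤ M ^ (x * r) :=
    fun ha r => by rw [pow_mul]; exact Nat.pow_le_pow_left ha r
  have kpow_mono : ∀ {x y : ℕ}, 2 ≤ M → x ≤ y → M ^ x ≤ M ^ y :=
    fun hM h => Nat.pow_le_pow_right (by omega) h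
  have kself_le_pow : 2 ≤ M → ∀ x : ℕ, x ≤ M ^ x :=
    fun hM x => (Nat.lt_two_pow_self).le.trans (Nat.pow_le_pow_left hM x)
  -- rounds and widths
  have hR1 : rounds d (k ^ 2) ≤ 8 * k := by
    unfold rounds
    apply Nat.div_le_of_le_mul
    have : (k ^ 2 + 1) * (8 * k) = 8 * k ^ 3 + 8 * k := by ring
    rw [this]; omega
  have hR2 : rounds (k ^ 2) k ≤ 8 * k := by
    unfold rounds
    apply Nat.div_le_of_le_mul
    have : (k + 1) * (8 * k) = 8 * k ^ 2 + 8 * k := by ring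
    rw [this]; omega
  have hW1' : width d (k ^ 2) ≤ 33 * k := by unfold width; omega
  have hW2' : width (k ^ 2) k ≤ 33 * k := by unfold width; omega
  have hW1 : width d (k ^ 2) ≤ M ^ (33 * k) := (kself_le_pow hM _).trans (kpow_mono hM hW1')
  have hW2 : width (k ^ 2) k ≤ M ^ (33 * k) := (kself_le_pow hM _).trans (kpow_mono hM hW2')
  have h2W2 : 2 ^ width (k ^ 2) k ≤ M ^ (33 * k) :=
    (Nat.pow_le_pow_left hM _).trans (kpow_mono hM hW2')
  have h2k : 2 ^ k ≤ M ^ k := Nat.pow_le_pow_left hM k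
  have hkk : k ≤ M ^ k := kself_le_pow hM k
  -- node counts
  have hS : nodeBound s d ≤ M ^ 5 := by
    unfold nodeBound
    have h4 : 4 ≤ M ^ 2 := by rw [pow_two]; exact Nat.mul_le_mul hM hM
    calc 4 * s * (d + 1) ^ 2 ≤ M ^ 2 * M * M ^ 2 :=
          Nat.mul_le_mul (Nat.mul_le_mul h4 hs) (Nat.pow_le_pow_left hd1 2)
      _ = M ^ 5 := by ring
  have hSS : nodeBound s d * nodeBound s d ≤ M ^ 10 :=
    (kle_pow_mul hS hS).trans (kpow_mono hM (by norm_num))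
  have hS10 : nodeBound s d ≤ M ^ 10 := hS.trans (kpow_mono hM (by norm_num))
  have hS' : nodeBound s d + nodeBound s d * nodeBound s d ≤ M ^ 11 :=
    (kadd_le_pow hM hS10 hSS).trans (kpow_mono hM (by norm_num))
  -- the GKKS monomial bound `mmax N k = (N+1)^k 2^k`
  have hN1 : N + 1 ≤ M ^ 2 :=
    calc N + 1 ≤ M + M := Nat.add_le_add hN (by omega)
      _ = M * 2 := by ring
      _ ≤ M * M := Nat.mul_le_mul_left _ hM
      _ = M ^ 2 := by rw [pow_two]
  have hmm : mmax N k ≤ M ^ (3 * k) := by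
    unfold mmax
    refine (Nat.mul_le_mul (kpow_le_pow_mul hN1 k) h2k).trans ?_
    rw [← pow_add]
    exact kpow_mono hM (by omega)
  -- the piece bound `U·D + U + 1`
  have hT2 : ((nodeBound s d + nodeBound s d * nodeBound s d) *
      (nodeBound s d + nodeBound s d * nodeBound s d)) ^ rounds (k ^ 2) k ≤ M ^ (176 * k) :=
    (kpow_le_pow_mul (kle_pow_mul hS' hS') _).trans (kpow_mono hM (by omega))
  have hU2 : 2 ^ width (k ^ 2) k * ((mmax N k + 1) * width (k ^ 2) k + 1) ≤ M ^ (69 * k + 2) :=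
    (kle_pow_mul h2W2 (ksucc_le_pow hM (kle_pow_mul (ksucc_le_pow hM hmm) hW2))).trans
      (kpow_mono hM (by omega))
  have hU : ((nodeBound s d + nodeBound s d * nodeBound s d) *
      (nodeBound s d + nodeBound s d * nodeBound s d)) ^ rounds (k ^ 2) k *
        (2 ^ width (k ^ 2) k * ((mmax N k + 1) * width (k ^ 2) k + 1)) ≤ M ^ (245 * k + 2) :=
    (kle_pow_mul hT2 hU2).trans (kpow_mono hM (by omega))
  have hD : mmax N k * (k * width (k ^ 2) k) ≤ M ^ (37 * k) :=
    (kle_pow_mul hmm (kle_pow_mul hkk hW2)).trans (kpow_mono hM (by omega))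
  have hPB : pieceBound (nodeBound s d) N (k ^ 2) k ≤ M ^ (287 * k) := by
    unfold pieceBound spsGates
    exact (ksucc_le_pow hM (kadd_le_pow hM (kle_pow_mul hU hD)
      (hU.trans (kpow_mono hM (by omega))))).trans (kpow_mono hM (by omega))
  -- the term count and the total
  have hd1' : d + 1 ≤ M ^ 1 := by rw [pow_one]; exact hd1
  have hT1 : (d + 1) * (nodeBound s d * nodeBound s d) ^ rounds d (k ^ 2) ≤ M ^ (81 * k) :=
    (kle_pow_mul hd1' (kpow_le_pow_mul hSS _)).trans (kpow_mono hM (by omega))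
  have hmain : (d + 1) * (nodeBound s d * nodeBound s d) ^ rounds d (k ^ 2) * width d (k ^ 2) *
      pieceBound (nodeBound s d) N (k ^ 2) k ≤ M ^ (401 * k) :=
    (kle_pow_mul (kle_pow_mul hT1 hW1) hPB).trans (kpow_mono hM (by omega))
  have hrest : (d + 1) * (nodeBound s d * nodeBound s d) ^ rounds d (k ^ 2) * width d (k ^ 2) +
      ((d + 1) * (nodeBound s d * nodeBound s d) ^ rounds d (k ^ 2)) + 1 ≤ M ^ (401 * k) := by
    have h1 : (d + 1) * (nodeBound s d * nodeBound s d) ^ rounds d (k ^ 2) * width d (k ^ 2) ≤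
        M ^ (114 * k) := (kle_pow_mul hT1 hW1).trans (kpow_mono hM (by omega))
    have h2 : (d + 1) * (nodeBound s d * nodeBound s d) ^ rounds d (k ^ 2) ≤ M ^ (114 * k) :=
      hT1.trans (kpow_mono hM (by omega))
    exact (ksucc_le_pow hM (kadd_le_pow hM h1 h2)).trans (kpow_mono hM (by omega))
  unfold slpBound
  exact (kadd_le_pow hM hmain hrest).trans (kpow_mono hM (by omega))

end Arithmetic

/-- **The cube-root chasm holds** (Kumar–Saptharishi 2017, Lemma 29, for `VP` families over `ℂ`):
`DepthFiveChasm`, with `c = 402·(a₁+a₂+a₃+2)` from the p-bounds of variables, degree, complexity.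
[cite: KumarSaptharishi2017, Lemma 28–29; Tavenas2015, Thm. 1; GuptaKamathKayalSaptharishi2016, §4] -/
theorem depthFiveChasm_holds : DepthFiveChasm := by
  intro σ _ f hf
  classical
  obtain ⟨⟨⟨a1, h1⟩, ⟨a2, h2⟩⟩, ⟨a3, h3⟩⟩ := hf
  refine ⟨402 * (a1 + a2 + a3 + 2), fun n k hdk => ?_⟩
  -- a circuit with at most (n+2)^(c k + c) gates
  suffices hC : ∃ C : ArithCircuit ℂ (σ n), C.eval = f n ∧ C.productDepth ≤ 2 ∧
      C.size ≤ (n + 2) ^ (402 * (a1 + a2 + a3 + 2) * k + 402 * (a1 + a2 + a3 + 2)) by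
    obtain ⟨C, hCe, hCd, hCs⟩ := hC
    refine (productDepthCircuitSize_le hCe hCd).trans ?_
    exact_mod_cast hCs
  have hB : 2 ≤ n + 2 := by omega
  have hN : Fintype.card (σ n) ≤ 2 * (n + 2) ^ (a1 + a2 + a3) := le_two_mul_pow (h1 n) (by omega)
  have hdeg : (f n).totalDegree ≤ 2 * (n + 2) ^ (a1 + a2 + a3) := le_two_mul_pow (h2 n) (by omega)
  have hcx : complexity (f n) ≤ 2 * (n + 2) ^ (a1 + a2 + a3) := le_two_mul_pow (h3 n) (by omega)
  have h4 := four_mul_pow_le (n + 2) (a1 + a2 + a3) hB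
  have hone : 1 ≤ (n + 2) ^ (a1 + a2 + a3) := Nat.one_le_pow _ _ (by omega)
  have hM : 2 ≤ (n + 2) ^ (a1 + a2 + a3 + 2) :=
    hB.trans (Nat.le_self_pow (by omega) _)
  by_cases hd0 : (f n).totalDegree = 0
  · refine ⟨ArithCircuit.ofConst ((f n).coeff 0), ?_, by rw [productDepth_ofConst]; exact Nat.zero_le _,
      by rw [ArithCircuit.size_ofConst]; exact Nat.zero_le _⟩
    rw [ArithCircuit.eval_ofConst]; exact (totalDegree_eq_zero_iff_eq_C.1 hd0).symm
  have hk1 : 1 ≤ k := by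
    rcases Nat.eq_zero_or_pos k with rfl | h
    · exact absurd (by simpa using hdk) hd0
    · exact h
  -- a polynomial of positive degree has a variable (GKKS needs an inhabited variable type)
  haveI : Inhabited (σ n) := by
    refine Classical.inhabited_of_nonempty ?_
    by_contra hne
    haveI : IsEmpty (σ n) := not_nonempty_iff.1 hne
    exact hd0 (by rw [MvPolynomial.eq_C_of_isEmpty (f n), totalDegree_C])
  obtain ⟨P, hfan, hcomp, hsize⟩ := ArithCircuit.exists_computes_size_eq_complexity (f n)
  obtain ⟨S, hlen, hcases⟩ := exists_slp P hfan
  rw [show P.eval = f n from hcomp] at hcases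
  rcases hcases with ⟨i, hi, hgi⟩ | ⟨j, hgj⟩ | ⟨c, hgc⟩
  · have hdi : (S.val i).totalDegree ≤ (f n).totalDegree := by rw [← hgi]
    obtain ⟨C, hCe, hCd, hCs⟩ := exists_pd2_circuit_of_slp S hi hdi hk1
    refine ⟨C, hCe.trans hgi.symm, hCd, hCs.trans ?_⟩
    have hs : S.len ≤ 2 * (n + 2) ^ (a1 + a2 + a3) := by rw [hlen, hsize]; exact hcx
    refine (slpBound_le_pow hM (by omega) (by omega) (by omega) hk1 hdk).trans ?_
    rw [← pow_mul]
    apply Nat.pow_le_pow_right (by omega)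
    calc (a1 + a2 + a3 + 2) * (402 * k) = 402 * (a1 + a2 + a3 + 2) * k := by ring
      _ ≤ 402 * (a1 + a2 + a3 + 2) * k + 402 * (a1 + a2 + a3 + 2) := Nat.le_add_right _ _
  · exact ⟨ArithCircuit.ofVar j, by rw [ArithCircuit.eval_ofVar, hgj],
      by rw [productDepth_ofVar]; exact Nat.zero_le _,
      by rw [ArithCircuit.size_ofVar]; exact Nat.zero_le _⟩
  · exact ⟨ArithCircuit.ofConst c, by rw [ArithCircuit.eval_ofConst, hgc],
      by rw [productDepth_ofConst]; exact Nat.zero_le _,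
      by rw [ArithCircuit.size_ofConst]; exact Nat.zero_le _⟩

/-- **`Depth5InhomThesis` decides the summit, unconditionally** (the tree's `vh_of_depthFiveChasm` with
its hypothesis `DepthFiveChasm` discharged). [cite: KumarSaptharishi2017, p. 31:5 and Lemma 29] -/
theorem vh_of_depth5InhomThesis (h : Depth5InhomThesis) : _root_.ValiantsHypothesis :=
  vh_of_depthFiveChasm depthFiveChasm_holds h

/-- **Item 0331 (`Depth4GeneralExp`) decides the summit, unconditionally**: an eventual `2^{⌊√n⌋/c'}`
lower bound for INHOMOGENEOUS product-depth-2 circuits of the permanent gives `VP ≠ VNP` (the tree's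
`vh_of_depthFiveChasm_of_depth4GeneralExp`, discharged). [cite: KumarSaptharishi2017, Lemma 29] -/
theorem vh_of_depth4GeneralExp (h : Depth4GeneralExp) : _root_.ValiantsHypothesis :=
  vh_of_depthFiveChasm_of_depth4GeneralExp depthFiveChasm_holds h

/-- **The meta-lock of the depth-5 cell, unconditionally**: no measure sound for
`productDepthCircuitSize 2` and `VP`-saturated at the permanent witnesses `Depth5InhomThesis` (the
tree's `not_depth5Inhom_witness_of_vpSaturated`, discharged). [cite: KumarSaraf2017, Cor. 1.3] -/
theorem not_depth5Inhom_witness_of_vpSaturated'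
    {μ : ∀ ⦃σ : Type⦄, MvPolynomial σ ℂ → ℕ∞}
    (hμ : ∀ ⦃σ : Type⦄ [Fintype σ] (f : MvPolynomial σ ℂ), μ f ≤ productDepthCircuitSize 2 f)
    {C : ℕ} {σ : ℕ → Type} [∀ n, Fintype (σ n)] {g : ∀ n, MvPolynomial (σ n) ℂ}
    (hg : IsVPFamily g) (hdeg : ∀ n, (g n).totalDegree ≤ n)
    (hle : ∀ n : ℕ, 0 ≤ n → μ (perPoly (Fin n) ℂ) ≤ μ (g n) ^ C) :
    ¬ ∀ c : ℕ, ∃ n k : ℕ, n ≤ k ^ 3 ∧ ((n + 2 : ℕ∞) ^ (c * k + c)) < μ (perPoly (Fin n) ℂ) :=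
  not_depth5Inhom_witness_of_vpSaturated depthFiveChasm_holds hμ hg hdeg hle

end Summit.ValiantsHypothesis.ValiantsHypothesis.Theorems.Depth5Chasm

end
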